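import Literature.NumberTheory.Sieve.SmoothEndgameCentral
import Literature.NumberTheory.Sieve.SmoothEndgameMajor
import Literature.NumberTheory.Sieve.SmoothEndgameTail
import HarnessLib

/-!
# The endgame for smooth `a + b = c`: the weighted count

Topic `Literature/NumberTheory/Sieve`; a PROVED file toward
`Literature.NumberTheory.DiophantineGeometry.XYZUpperHalf` ([Harper2016, Cor. 1], §5 with the
smooth weight `w(v) = v²(1−v)²`). With `N₀ = ⌊x⌋`, `w₁(a) = 1_{S(x/2,y)}(a) w(2a/x)`,
`w₃(c) = 1_{S(x,y)}(c) w(c/x)`, the weighted count of `a + b = c` in `y`-smooth numbers is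

`𝒩_w = ∑_{a,b ≤ N₀} w₁(a) w₁(b) w₃(a+b) = N₀⁻¹ ∑_{r mod N₀} S₁(r/N₀)² S̄₃(r/N₀)`

(`circle_count_smooth`, from `Endgame.circle_identity`), and likewise for the models
(`circle_count_model`). Splitting `r` into central points, arcs `a/q` (`2 ≤ q ≤ Λ/2`) and minor
points (`SmoothEndgameCentral`, `SmoothEndgameMajor`, `SmoothEndgameTail`) and comparing with the
model count `≥ 𝓜₁²𝓜/(2²⁸ x)` (`model_count_ge`):

`count_lower_bound`: in the regime of the endgame, `𝒩_w ≥ 𝓜₁² 𝓜/(2²⁹ x)`.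

## References

* A. J. Harper, Compositio Math. 152 (2016), §5 [Harper2016].
-/

noncomputable section

open Finset Real Complex
open scoped FourierTransform ComplexConjugate Classical

namespace Literature.NumberTheory.Sieve

namespace Endgame

open MontgomeryVaughan1975 TwistedWeight SmoothArcs Vinogradov

/-! ### The circle identities for real weights -/

/-- `∑_{r mod N₀} F(r)² K̄(r) = N₀ ∑_{a,b} w₁(a) w₁(b) w₃(a+b)` for real weights `w₁` (vanishing for
`2a > N₀`) and `w₃`, `F(r) = ∑_a w₁(a) e(ar/N₀)`, `K(r) = ∑_c w₃(c) e(cr/N₀)`.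
[cite: Harper2016, §5] -/
theorem circle_identity_real {N₀ : ℕ} (hN : N₀ ≠ 0) (w₁ w₃ : ℕ → ℝ) (hw₁ : ∀ a, N₀ < 2 * a → w₁ a = 0) :
    ∑ r ∈ Finset.range N₀, (∑ a ∈ Finset.Icc 1 N₀, (w₁ a : ℂ) * (𝐞 ((a : ℝ) * r / N₀) : ℂ)) ^ 2 *
        conj (∑ c ∈ Finset.Icc 1 N₀, (w₃ c : ℂ) * (𝐞 ((c : ℝ) * r / N₀) : ℂ)) =
      (N₀ : ℂ) * ((∑ a ∈ Finset.Icc 1 N₀, ∑ b ∈ Finset.Icc 1 N₀, w₁ a * w₁ b * w₃ (a + b) : ℝ) : ℂ) := by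
  have h := circle_identity hN (fun a => (w₁ a : ℂ)) (fun a => (w₁ a : ℂ)) (fun c => (w₃ c : ℂ))
    (fun a ha => by simp [hw₁ a ha]) (fun a ha => by simp [hw₁ a ha])
  simp only [Complex.conj_ofReal] at h
  simp_rw [sq]
  rw [h]
  push_cast
  rfl

/-- **The weighted count on the circle.** With `N₀ = ⌊x⌋` (`x ≥ 1`), `S₁ = S_w(·; x/2)`,
`S₃ = S_w(·; x)`:
`∑_{r<N₀} S₁(r/N₀)² S̄₃(r/N₀) = N₀ ∑_{a,b ≤ N₀} w₁(a) w₁(b) w₃(a+b)`. [cite: Harper2016, §5] -/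
theorem circle_count_smooth {x : ℝ} (hx : 1 ≤ x) (y : ℕ) :
    ∑ r ∈ Finset.range ⌊x⌋₊, smoothWeightSum (x / 2) y ((r : ℝ) / ⌊x⌋₊) ^ 2 *
        conj (smoothWeightSum x y ((r : ℝ) / ⌊x⌋₊)) =
      (⌊x⌋₊ : ℂ) * ((∑ a ∈ Finset.Icc 1 ⌊x⌋₊, ∑ b ∈ Finset.Icc 1 ⌊x⌋₊,
        (if a ∈ Nat.smoothNumbersUpTo ⌊x / 2⌋₊ (y + 1) then wt ((a : ℝ) / (x / 2)) else 0) *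
        (if b ∈ Nat.smoothNumbersUpTo ⌊x / 2⌋₊ (y + 1) then wt ((b : ℝ) / (x / 2)) else 0) *
        (if a + b ∈ Nat.smoothNumbersUpTo ⌊x⌋₊ (y + 1) then wt (((a + b : ℕ) : ℝ) / x) else 0) : ℝ) : ℂ) := by
  have hx0 : 0 < x := by linarith
  have hN1 : 1 ≤ ⌊x⌋₊ := Nat.le_floor (by simpa using hx)
  have hN : ⌊x⌋₊ ≠ 0 := by omega
  set w₁ : ℕ → ℝ := fun a => if a ∈ Nat.smoothNumbersUpTo ⌊x / 2⌋₊ (y + 1) then wt ((a : ℝ) / (x / 2)) else 0 with hw₁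
  set w₃ : ℕ → ℝ := fun c => if c ∈ Nat.smoothNumbersUpTo ⌊x⌋₊ (y + 1) then wt ((c : ℝ) / x) else 0 with hw₃
  have hw₁0 : ∀ a, ⌊x⌋₊ < 2 * a → w₁ a = 0 := by
    intro a ha
    simp only [hw₁]
    rw [if_neg]
    intro hmem
    have hle : a ≤ ⌊x / 2⌋₊ := (Nat.mem_smoothNumbersUpTo.mp hmem).1
    have h2 : (2 * a : ℕ) ≤ ⌊x⌋₊ := by
      refine Nat.le_floor ?_
      push_cast
      have : (a : ℝ) ≤ x / 2 := le_trans (by exact_mod_cast hle) (Nat.floor_le (by positivity))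
      linarith
    omega
  have h := circle_identity_real hN w₁ w₃ hw₁0
  -- identify `F(r)` with `S₁(r/⌊x⌋₊)` and `K(r)` with `S₃(r/⌊x⌋₊)`
  have hsub₂ : Nat.smoothNumbersUpTo ⌊x / 2⌋₊ (y + 1) ⊆ Finset.Icc 1 ⌊x⌋₊ := by
    intro a ha
    rw [Nat.mem_smoothNumbersUpTo] at ha
    exact Finset.mem_Icc.mpr ⟨Nat.pos_of_ne_zero (Nat.ne_zero_of_mem_smoothNumbers ha.2),
      ha.1.trans (Nat.floor_le_floor (by linarith))⟩
  have hsub₃ : Nat.smoothNumbersUpTo ⌊x⌋₊ (y + 1) ⊆ Finset.Icc 1 ⌊x⌋₊ := by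
    intro a ha
    rw [Nat.mem_smoothNumbersUpTo] at ha
    exact Finset.mem_Icc.mpr ⟨Nat.pos_of_ne_zero (Nat.ne_zero_of_mem_smoothNumbers ha.2), ha.1⟩
  have hF : ∀ r : ℕ, ∑ a ∈ Finset.Icc 1 ⌊x⌋₊, (w₁ a : ℂ) * (𝐞 ((a : ℝ) * r / ⌊x⌋₊) : ℂ) =
      smoothWeightSum (x / 2) y ((r : ℝ) / ⌊x⌋₊) := by
    intro r
    rw [smoothWeightSum, ← Finset.sum_subset hsub₂]
    · refine Finset.sum_congr rfl fun a ha => ?_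
      simp only [hw₁, if_pos ha, mul_div_assoc]
    · intro a _ ha
      simp only [hw₁, if_neg ha, Complex.ofReal_zero, zero_mul]
  have hK : ∀ r : ℕ, ∑ c ∈ Finset.Icc 1 ⌊x⌋₊, (w₃ c : ℂ) * (𝐞 ((c : ℝ) * r / ⌊x⌋₊) : ℂ) =
      smoothWeightSum x y ((r : ℝ) / ⌊x⌋₊) := by
    intro r
    rw [smoothWeightSum, ← Finset.sum_subset hsub₃]
    · refine Finset.sum_congr rfl fun c hc => ?_
      simp only [hw₃, if_pos hc, mul_div_assoc]
    · intro c _ hc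
      simp only [hw₃, if_neg hc, Complex.ofReal_zero, zero_mul]
  simp_rw [hF, hK] at h
  rw [h]

/-- **The model count on the circle.** With `N₀ = ⌊x⌋` (`x ≥ 1`), `M₁ = M_{𝓜₁, x/2, α}`,
`M₃ = M_{𝓜, x, α}`: `∑_{r<N₀} M₁(r/N₀)² M̄₃(r/N₀) = N₀ ∑_{a,b ≤ N₀} m₁(a) m₁(b) m₃(a+b)`.
[cite: Harper2016, §5] -/
theorem circle_count_model {x : ℝ} (hx : 1 ≤ x) (M M₁ α : ℝ) :
    ∑ r ∈ Finset.range ⌊x⌋₊, modelSum M₁ (x / 2) α ((r : ℝ) / ⌊x⌋₊) ^ 2 * conj (modelSum M x α ((r : ℝ) / ⌊x⌋₊)) =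
      (⌊x⌋₊ : ℂ) * ((∑ a ∈ Finset.Icc 1 ⌊x⌋₊, ∑ b ∈ Finset.Icc 1 ⌊x⌋₊,
        modelWeight M₁ (x / 2) α a * modelWeight M₁ (x / 2) α b * modelWeight M x α (a + b) : ℝ) : ℂ) := by
  have hx0 : 0 < x := by linarith
  have hN1 : 1 ≤ ⌊x⌋₊ := Nat.le_floor (by simpa using hx)
  have hN : ⌊x⌋₊ ≠ 0 := by omega
  have hw₁0 : ∀ a, ⌊x⌋₊ < 2 * a → modelWeight M₁ (x / 2) α a = 0 := by
    intro a ha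
    apply modelWeight_eq_zero
    rintro ⟨-, hax⟩
    have h2 : (2 * a : ℕ) ≤ ⌊x⌋₊ := by
      refine Nat.le_floor ?_
      push_cast; linarith
    omega
  have h := circle_identity_real hN (modelWeight M₁ (x / 2) α) (modelWeight M x α) hw₁0
  have hsub : Finset.Icc 1 ⌊x / 2⌋₊ ⊆ Finset.Icc 1 ⌊x⌋₊ := by
    intro a ha
    obtain ⟨h1, h2⟩ := Finset.mem_Icc.mp ha
    exact Finset.mem_Icc.mpr ⟨h1, h2.trans (Nat.floor_le_floor (by linarith))⟩
  have hF : ∀ r : ℕ, ∑ a ∈ Finset.Icc 1 ⌊x⌋₊, (modelWeight M₁ (x / 2) α a : ℂ) * (𝐞 ((a : ℝ) * r / ⌊x⌋₊) : ℂ) =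
      modelSum M₁ (x / 2) α ((r : ℝ) / ⌊x⌋₊) := by
    intro r
    rw [modelSum, ← Finset.sum_subset hsub]
    · refine Finset.sum_congr rfl fun a _ => ?_
      rw [mul_div_assoc]
    · intro a _ ha
      rw [modelWeight_eq_zero, Complex.ofReal_zero, zero_mul]
      rintro ⟨h1, hax⟩
      exact ha (Finset.mem_Icc.mpr ⟨h1, Nat.le_floor hax⟩)
  have hK : ∀ r : ℕ, ∑ c ∈ Finset.Icc 1 ⌊x⌋₊, (modelWeight M x α c : ℂ) * (𝐞 ((c : ℝ) * r / ⌊x⌋₊) : ℂ) =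
      modelSum M x α ((r : ℝ) / ⌊x⌋₊) := by
    intro r
    rw [modelSum]
    refine Finset.sum_congr rfl fun c _ => ?_
    rw [mul_div_assoc]
  simp_rw [hF, hK] at h
  rw [h]


/-! ### The lower bound for the weighted count -/

/-- `3200 e^{−66} ≤ 2^{−32}`. [folklore] -/
theorem numeric_central : 3200 * Real.exp (-66) ≤ (1 / 2 : ℝ) ^ 32 := by
  have h := exp_neg_66_le_pow
  have : 3200 * ((2718 / 1000 : ℝ) ^ 66)⁻¹ ≤ (1 / 2 : ℝ) ^ 32 := by norm_num
  linarith

set_option maxHeartbeats 3200000 in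
/-- **The weighted count of smooth `a + b = c`.** Let `0 ≤ δ₀ ≤ 1/20`, `0 < θ ≤ 1/5`. There are
`C, C', x₀` such that for `x ≥ x₀`, `(log x)^8 ≤ y`, `y^{200} ≤ x`, `log y ≤ ½ (log x)^{1/6}`, `y` a
large good level, `1 − 5·10⁻⁷ ≤ α(x,y)`, `x^{39999/40000} ≤ Ψ(x,y)`, a parameter `2^{40} ≤ Λ` with
`Λ⁸ ≤ y`, `Λ ≤ y^θ`, `Λ ≤ (log x)^{100}`, `Λ/2 ≤ x^{1/10}`, and the two smallness conditions (junk of the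
arcs; minor arcs), the weighted count satisfies
`∑_{a,b ≤ ⌊x⌋} w₁(a) w₁(b) w₃(a+b) ≥ 𝓜₁² 𝓜/(2²⁹ x)` (`𝓜 = x^αζ(α,y)/√(2πφ₂(α,y))`, `𝓜₁ = 2^{−α}𝓜`).
[cite: Harper2016, §5, Cor. 1] -/
theorem count_lower_bound {δ₀ θ : ℝ} (hδ₀ : 0 ≤ δ₀) (hδ₀' : δ₀ ≤ 1 / 20) (hθ0 : 0 < θ) (hθ : θ ≤ 1 / 5) :
    ∃ C C' x₀ : ℝ, 0 < C ∧ 0 < C' ∧ ∀ (x : ℝ) (y : ℕ), x₀ ≤ x → Real.log x ^ 8 ≤ y → (y : ℝ) ^ 200 ≤ x →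
      Real.log y ≤ 1 / 2 * Real.log x ^ (1 / 6 : ℝ) → GoodLevel δ₀ θ y → 25 ≤ Real.log y →
      40 * ((y : ℝ) ^ (1 - θ) + 1) ≤ (y : ℝ) ^ (1 - θ / 2) → (y : ℝ) ^ θ + 1 ≤ (y : ℝ) ^ (1 - θ / 2) →
      3 * (y : ℝ) ^ (1 - θ / 2) ≤ y →
      1 - 1 / 2000000 ≤ saddlePoint x y →
      x ^ ((39999 : ℝ) / 40000) ≤ ((Nat.smoothNumbersUpTo ⌊x⌋₊ (y + 1)).card : ℝ) →
      ∀ Λ : ℝ, 2 ^ 40 ≤ Λ → Λ ^ 8 ≤ (y : ℝ) → Λ ≤ (y : ℝ) ^ θ → Λ ≤ Real.log x ^ 100 → Λ / 2 ≤ x ^ (1 / 10 : ℝ) →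
      (1 + Λ) * (Λ ^ 4 * ((x ^ saddlePoint x y * smoothZeta (saddlePoint x y) y / (2 * π)) *
          decayNu y θ (saddlePoint x y) Λ) +
        2 * (x ^ saddlePoint x y * smoothZeta (saddlePoint x y) y /
          Real.sqrt (2 * Real.pi * saddlePhi₂ (saddlePoint x y) y)) * (5 + 2 * π * Λ) / x) ≤
        Real.exp (-66) * ((2 : ℝ) ^ (-saddlePoint x y) * (x ^ saddlePoint x y * smoothZeta (saddlePoint x y) y /
          Real.sqrt (2 * Real.pi * saddlePhi₂ (saddlePoint x y) y))) →
      C * Real.log x ^ (19 : ℕ) * (x ^ saddlePoint x y *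
            (smoothZeta (saddlePoint x y) y / Real.sqrt (saddlePhi₂ (saddlePoint x y) y))) ^ ((5 : ℝ) / 2) *
          Real.sqrt (C' * Real.log x ^ 3 * (y : ℝ) ^ (5 / 2 * (1 - saddlePoint x y)) *
              (Λ / 2) ^ (-(1 / 2 : ℝ) + 3 / 2 * (1 - saddlePoint x y)) *
              (x ^ saddlePoint x y * (smoothZeta (saddlePoint x y) y / Real.sqrt (saddlePhi₂ (saddlePoint x y) y))) +
            164 * (1 + Real.log x) ^ 2 * (y : ℝ) ^ 2 * x ^ (9 / 10 : ℝ) +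
            32 * ((Nat.smoothNumbersUpTo ⌊x⌋₊ (y + 1)).card : ℝ) / (Λ / 2) ^ 2 + 1) ≤
        (((2 : ℝ) ^ (-saddlePoint x y) * (x ^ saddlePoint x y * smoothZeta (saddlePoint x y) y /
              Real.sqrt (2 * Real.pi * saddlePhi₂ (saddlePoint x y) y))) ^ 2 *
            (x ^ saddlePoint x y * smoothZeta (saddlePoint x y) y /
              Real.sqrt (2 * Real.pi * saddlePhi₂ (saddlePoint x y) y))) * (1 / 2 : ℝ) ^ 32 →
      (((2 : ℝ) ^ (-saddlePoint x y) * (x ^ saddlePoint x y * smoothZeta (saddlePoint x y) y /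
            Real.sqrt (2 * Real.pi * saddlePhi₂ (saddlePoint x y) y))) ^ 2 *
          (x ^ saddlePoint x y * smoothZeta (saddlePoint x y) y /
            Real.sqrt (2 * Real.pi * saddlePhi₂ (saddlePoint x y) y))) / (2 ^ 29 * x) ≤
        ∑ a ∈ Finset.Icc 1 ⌊x⌋₊, ∑ b ∈ Finset.Icc 1 ⌊x⌋₊,
          (if a ∈ Nat.smoothNumbersUpTo ⌊x / 2⌋₊ (y + 1) then wt ((a : ℝ) / (x / 2)) else 0) *
          (if b ∈ Nat.smoothNumbersUpTo ⌊x / 2⌋₊ (y + 1) then wt ((b : ℝ) / (x / 2)) else 0) *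
          (if a + b ∈ Nat.smoothNumbersUpTo ⌊x⌋₊ (y + 1) then wt (((a + b : ℕ) : ℝ) / x) else 0) := by
  have hε : (0 : ℝ) < Real.exp (-66) := Real.exp_pos _
  have hε20 : Real.exp (-66) ≤ 1 / 20 := by
    have h := exp_neg_66_le_pow
    have : ((2718 / 1000 : ℝ) ^ 66)⁻¹ ≤ 1 / 20 := by norm_num
    linarith
  obtain ⟨x₀C, hCen⟩ := central_sum_le hε hε20 hδ₀ hδ₀' hθ0 hθ
  obtain ⟨x₀A, hArc⟩ := arcs_sum_le hε le_rfl hδ₀ hδ₀' hθ0 hθ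
  obtain ⟨C, C', x₀T, hC, hC', hMin⟩ := minor_sum_le
  obtain ⟨x₁, hlt1⟩ := saddlePoint_lt_one
  refine ⟨C, C', max (max (max x₀C x₀A) (max x₀T x₁)) 64, hC, hC',
    fun x y hx hy8 hy200 hylog hgood hy25 hy40 hyq hy3 hαlo hΨ Λ hΛ40 hΛ8 hΛθ hΛL hΛx hsmall hminor => ?_⟩
  have hx₀C : x₀C ≤ x := le_trans ((le_max_left _ _).trans ((le_max_left _ _).trans (le_max_left _ _))) hx
  have hx₀A : x₀A ≤ x := le_trans ((le_max_right _ _).trans ((le_max_left _ _).trans (le_max_left _ _))) hx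
  have hx₀T : x₀T ≤ x := le_trans ((le_max_left _ _).trans ((le_max_right _ _).trans (le_max_left _ _))) hx
  have hx₁ : x₁ ≤ x := le_trans ((le_max_right _ _).trans ((le_max_right _ _).trans (le_max_left _ _))) hx
  have hx64 : 64 ≤ x := le_trans (le_max_right _ _) hx
  have hx0 : 0 < x := by linarith
  have hx1 : 1 ≤ x := by linarith
  have hx2 : 2 ≤ x := by linarith
  -- ### derived range facts
  have hlogx1 : 1 ≤ Real.log x := by
    rw [Real.le_log_iff_exp_le hx0]
    have := Real.exp_one_lt_d9; linarith
  have hy4 : Real.log x ^ 4 ≤ y := le_trans (pow_le_pow_right₀ hlogx1 (by norm_num)) hy8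
  have hy3' : Real.log x ^ 3 ≤ y := le_trans (pow_le_pow_right₀ hlogx1 (by norm_num)) hy8
  have hy2 : 2 ≤ y := by
    have hy1 : (1 : ℝ) < y := by
      by_contra h0; push Not at h0
      have := Real.log_nonpos (Nat.cast_nonneg y) h0; linarith
    have : 1 < y := by exact_mod_cast hy1
    omega
  have hy1r : (1 : ℝ) ≤ y := by exact_mod_cast (show 1 ≤ y by omega)
  have hyx : (y : ℝ) ≤ x := le_trans (by nlinarith [pow_le_pow_right₀ hy1r (show 1 ≤ 200 by norm_num)]) hy200
  have hylog6 : Real.log y ≤ Real.log x ^ (1 / 6 : ℝ) := by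
    have : 0 ≤ Real.log x ^ (1 / 6 : ℝ) := Real.rpow_nonneg (by linarith) _
    linarith
  have hΛ2 : 2 ≤ Λ := le_trans (by norm_num) hΛ40
  have hΛ1 : 1 ≤ Λ := by linarith
  have hΛsq : (Λ / 2) ^ 2 < x := by
    have h1 : (Λ / 2) ^ 2 ≤ (x ^ (1 / 10 : ℝ)) ^ 2 := pow_le_pow_left₀ (by linarith) hΛx 2
    have h2 : (x ^ (1 / 10 : ℝ)) ^ 2 = x ^ (1 / 5 : ℝ) := by
      rw [← Real.rpow_natCast, ← Real.rpow_mul hx0.le]; norm_num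
    have h3 : x ^ (1 / 5 : ℝ) < x := by
      conv_rhs => rw [← Real.rpow_one x]
      exact Real.rpow_lt_rpow_of_exponent_lt (by linarith) (by norm_num)
    linarith [h2 ▸ h1]
  -- ### the basic quantities
  set N₀ : ℕ := ⌊x⌋₊ with hN₀
  have hN₀1 : 1 ≤ N₀ := Nat.le_floor (by simpa using hx1)
  have hN₀x : (N₀ : ℝ) ≤ x := Nat.floor_le hx0.le
  have hN₀0 : (0 : ℝ) < N₀ := by exact_mod_cast hN₀1
  have hxN₀ : x < N₀ + 1 := Nat.lt_floor_add_one x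
  have hN₀half : x / 2 ≤ N₀ := by linarith
  set α : ℝ := saddlePoint x y with hα
  have hα1 : α ≤ 1 := (hlt1 x y hx₁ hy3' hyx hylog6).le
  have hα0 : 0 < α := by linarith
  set Mx : ℝ := x ^ α * smoothZeta α y / Real.sqrt (2 * Real.pi * saddlePhi₂ α y) with hMx
  set M₁ : ℝ := (2 : ℝ) ^ (-α) * Mx with hM₁
  set T : ℝ := M₁ ^ 2 * Mx with hT
  have hζ : 0 < smoothZeta α y := smoothZeta_pos hα0
  have hMx0 : 0 ≤ Mx := by rw [hMx]; positivity
  have h2α0 : 0 < (2 : ℝ) ^ (-α) := Real.rpow_pos_of_pos (by norm_num) _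
  have hM₁0 : 0 ≤ M₁ := by positivity
  have hT0 : 0 ≤ T := by positivity
  set 𝓝 : ℝ := (x ^ α * smoothZeta α y / (2 * π)) * decayNu y θ α Λ with h𝓝
  have hπ := Real.pi_pos
  have h𝓝0 : 0 ≤ 𝓝 := by have := decayNu_nonneg y θ α Λ; positivity
  set J : ℝ := 2 * Mx * (5 + 2 * π * Λ) / x with hJ
  have hJ0 : 0 ≤ J := by positivity
  -- ### the two smallness hypotheses for the central arc and the arcs `q ≥ 2`
  have hΛ4 : 1 ≤ Λ ^ 4 := one_le_pow₀ hΛ1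
  have hsmall_c : (1 + Λ) * (𝓝 + J) ≤ (Real.exp (-66) + Real.exp (-66)) * M₁ := by
    have h1 : 𝓝 ≤ Λ ^ 4 * 𝓝 := le_mul_of_one_le_left h𝓝0 hΛ4
    have h2 : (1 + Λ) * (𝓝 + J) ≤ (1 + Λ) * (Λ ^ 4 * 𝓝 + J) := mul_le_mul_of_nonneg_left (by linarith) (by linarith)
    have h3 : 0 ≤ Real.exp (-66) * M₁ := by positivity
    calc (1 + Λ) * (𝓝 + J) ≤ (1 + Λ) * (Λ ^ 4 * 𝓝 + J) := h2
      _ ≤ Real.exp (-66) * M₁ := by rw [h𝓝, hJ]; exact hsmall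
      _ ≤ (Real.exp (-66) + Real.exp (-66)) * M₁ := by linarith
  have hsmall_a : Λ ^ 4 * (1 + Λ) * 𝓝 ≤ Real.exp (-66) * M₁ := by
    calc Λ ^ 4 * (1 + Λ) * 𝓝 = (1 + Λ) * (Λ ^ 4 * 𝓝) := by ring
      _ ≤ (1 + Λ) * (Λ ^ 4 * 𝓝 + J) := mul_le_mul_of_nonneg_left (by linarith) (by linarith)
      _ ≤ Real.exp (-66) * M₁ := by rw [h𝓝, hJ]; exact hsmall
  -- ### the four bounds
  have hC1 := hCen x y hx₀C hy4 hyx hylog6 hgood hy25 hy40 hyq hy3 Λ hΛ2 hΛ8 hΛθ hΛL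
  rw [← hα] at hC1
  rw [← hMx] at hC1
  rw [← hM₁] at hC1
  have hCentral := hC1 (by rw [h𝓝, hJ] at hsmall_c; exact hsmall_c)
  have hA1 := hArc x y hx₀A hy4 hyx hylog6 hgood hy25 hy40 hyq hy3 Λ hΛ2 hΛ8 hΛθ hΛL
  rw [← hα] at hA1
  rw [← hMx] at hA1
  rw [← hM₁] at hA1
  have hArcs := hA1 (by rw [h𝓝] at hsmall_a; exact hsmall_a) hαlo
  have hMinor := hMin x y hx₀T hy8 hylog hy200 (by linarith) hΨ Λ hΛ2 hΛx
  rw [← hα] at hMinor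
  have hMinor' := hMinor.trans hminor
  have hModel := model_noncentral_sum_le (M := Mx) (M₁ := M₁) (Λ := Λ) hx2 hα0.le hα1 hMx0 hM₁0 (by linarith)
  -- ### the two circle identities and the model count
  have hidS := circle_count_smooth hx1 y
  have hidM := circle_count_model hx1 Mx M₁ α
  have hCountM := model_count_ge (M := Mx) (M' := M₁) (α := α) (α' := α) hMx0 hM₁0 hx64 hα0.le hα1 hα0.le hα1
    (N₀ := N₀) (by linarith)
  -- ### the difference of the cubic sums
  set dS : ℕ → ℂ := fun r => smoothWeightSum (x / 2) y ((r : ℝ) / N₀) ^ 2 * conj (smoothWeightSum x y ((r : ℝ) / N₀)) with hdS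
  set dM : ℕ → ℂ := fun r => modelSum M₁ (x / 2) α ((r : ℝ) / N₀) ^ 2 * conj (modelSum Mx x α ((r : ℝ) / N₀)) with hdM
  set CountW : ℝ := ∑ a ∈ Finset.Icc 1 N₀, ∑ b ∈ Finset.Icc 1 N₀,
      (if a ∈ Nat.smoothNumbersUpTo ⌊x / 2⌋₊ (y + 1) then wt ((a : ℝ) / (x / 2)) else 0) *
      (if b ∈ Nat.smoothNumbersUpTo ⌊x / 2⌋₊ (y + 1) then wt ((b : ℝ) / (x / 2)) else 0) *
      (if a + b ∈ Nat.smoothNumbersUpTo N₀ (y + 1) then wt (((a + b : ℕ) : ℝ) / x) else 0) with hCountW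
  set CountM : ℝ := ∑ a ∈ Finset.Icc 1 N₀, ∑ b ∈ Finset.Icc 1 N₀,
      modelWeight M₁ (x / 2) α a * modelWeight M₁ (x / 2) α b * modelWeight Mx x α (a + b) with hCountMdef
  have hsumS : ∑ r ∈ Finset.range N₀, dS r = (N₀ : ℂ) * (CountW : ℂ) := hidS
  have hsumM : ∑ r ∈ Finset.range N₀, dM r = (N₀ : ℂ) * (CountM : ℂ) := hidM
  -- `Σ ‖dS − dM‖ ≤ T/2^30`
  set cen : ℕ → Prop := fun r => (r : ℝ) * x / N₀ ≤ Λ / 2 ∨ ((N₀ : ℝ) - r) * x / N₀ ≤ Λ / 2 with hcen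
  have hsplit := Finset.sum_filter_add_sum_filter_not (Finset.range N₀) cen (fun r => ‖dS r - dM r‖)
  have hnc : ∑ r ∈ (Finset.range N₀).filter (fun r => ¬ cen r), ‖dS r - dM r‖ ≤
      (∑ r ∈ (Finset.range N₀).filter (fun r => ¬ cen r),
        ‖smoothWeightSum (x / 2) y ((r : ℝ) / N₀)‖ ^ 2 * ‖smoothWeightSum x y ((r : ℝ) / N₀)‖) +
      ∑ r ∈ (Finset.range N₀).filter (fun r => ¬ cen r),
        ‖modelSum M₁ (x / 2) α ((r : ℝ) / N₀)‖ ^ 2 * ‖modelSum Mx x α ((r : ℝ) / N₀)‖ := by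
    rw [← Finset.sum_add_distrib]
    refine Finset.sum_le_sum fun r _ => ?_
    calc ‖dS r - dM r‖ ≤ ‖dS r‖ + ‖dM r‖ := norm_sub_le _ _
      _ = _ := by
        simp only [hdS, hdM, norm_mul, norm_pow, Complex.norm_conj]
  have hcover := sum_noncentral_le_arcs_add_minor hx1 hΛ2 hΛsq
    (fun r => ‖smoothWeightSum (x / 2) y ((r : ℝ) / N₀)‖ ^ 2 * ‖smoothWeightSum x y ((r : ℝ) / N₀)‖)
    (fun r => by positivity)
  have hModel' : ∑ r ∈ (Finset.range N₀).filter (fun r => ¬ cen r),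
      ‖modelSum M₁ (x / 2) α ((r : ℝ) / N₀)‖ ^ 2 * ‖modelSum Mx x α ((r : ℝ) / N₀)‖ ≤ T * (1 / 2 : ℝ) ^ 32 := by
    refine hModel.trans ?_
    rw [hT, div_le_iff₀ (by linarith : (0 : ℝ) < Λ)]
    have : (10 : ℝ) ≤ (1 / 2 : ℝ) ^ 32 * Λ := by nlinarith
    nlinarith
  have htotal : ∑ r ∈ Finset.range N₀, ‖dS r - dM r‖ ≤ T * (1 / 2 : ℝ) ^ 30 := by
    rw [← hsplit]
    have h1 : ∑ r ∈ (Finset.range N₀).filter cen, ‖dS r - dM r‖ ≤ 1600 * (Real.exp (-66) + Real.exp (-66)) * T := hCentral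
    have h2 := hnc
    have h3 := hcover
    have h4 := hArcs
    have h5 := hMinor'
    have h6 := hModel'
    have hnum := numeric_central
    nlinarith
  -- ### conclude
  have hre : (N₀ : ℝ) * CountW - (N₀ : ℝ) * CountM = (∑ r ∈ Finset.range N₀, (dS r - dM r)).re := by
    rw [Finset.sum_sub_distrib, Complex.sub_re, hsumS, hsumM]
    simp [Complex.mul_re]
  have hre_ge : -(T * (1 / 2 : ℝ) ^ 30) ≤ (N₀ : ℝ) * CountW - (N₀ : ℝ) * CountM := by
    rw [hre]
    have h1 : |(∑ r ∈ Finset.range N₀, (dS r - dM r)).re| ≤ ‖∑ r ∈ Finset.range N₀, (dS r - dM r)‖ := Complex.abs_re_le_norm _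
    have h2 : ‖∑ r ∈ Finset.range N₀, (dS r - dM r)‖ ≤ ∑ r ∈ Finset.range N₀, ‖dS r - dM r‖ := norm_sum_le _ _
    have := neg_abs_le (∑ r ∈ Finset.range N₀, (dS r - dM r)).re
    linarith
  -- `CountW ≥ CountM − T/(2^30 N₀) ≥ T/(2^28 x) − T/(2^29 x)`
  have hkey : T / (2 ^ 28 * x) - T * (1 / 2 : ℝ) ^ 30 / N₀ ≤ CountW := by
    have h1 : (N₀ : ℝ) * CountM - T * (1 / 2 : ℝ) ^ 30 ≤ (N₀ : ℝ) * CountW := by linarith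
    have h2 : (N₀ : ℝ) * (T / (2 ^ 28 * x)) ≤ (N₀ : ℝ) * CountM := mul_le_mul_of_nonneg_left hCountM hN₀0.le
    have h3 : (N₀ : ℝ) * (T / (2 ^ 28 * x)) ≤ (N₀ : ℝ) * CountW + T * (1 / 2 : ℝ) ^ 30 := by linarith
    have h4 : T / (2 ^ 28 * x) - CountW ≤ T * (1 / 2 : ℝ) ^ 30 / N₀ := by
      have e1 : (T / (2 ^ 28 * x) - CountW) * N₀ = (N₀ : ℝ) * (T / (2 ^ 28 * x)) - (N₀ : ℝ) * CountW := by ring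
      rw [le_div_iff₀ hN₀0, e1]; linarith
    linarith
  have hN₀term : T * (1 / 2 : ℝ) ^ 30 / N₀ ≤ T / (2 ^ 29 * x) := by
    rw [div_le_div_iff₀ hN₀0 (by positivity)]
    have : T * (2 ^ 29 * x) ≤ T * (2 ^ 30 * N₀) := mul_le_mul_of_nonneg_left (by linarith) hT0
    nlinarith
  have : T / (2 ^ 29 * x) = T / (2 ^ 28 * x) - T / (2 ^ 29 * x) := by field_simp; ring
  rw [this]
  linarith

end Endgame

end Literature.NumberTheory.Sieve

end
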